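import Literature.NumberTheory.LFunctions.PiLiOscillationFromZero
import Literature.NumberTheory.LFunctions.ExplicitFormulaPsiOne

/-!
# PF persistence, fake seat 1 — the template line density and its Mellin transform

Unit `pub-rhpf-fake-1` of the `pub-rhpf` cell (mechanism / rigidity campaign; **no RH claims**);
analytic core of `HOME/FAKES.md §1.8.3′` (THEOREM F1-T₁).  At a fixed height `t` put
`H_t(x) = A(t) − 2 Σ_{n ≤ x} Λ(n) n^{-1/2} cos(t log n) + 4 Re( x^{1/2 − it} / (1 − 2it) )`,
`A(t) = Re ψ(1/4 + it/2) − log π`.  The pieces are measurable with linear bounds, and for `Re s > 1`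
`∫_1^∞ H_t(x) x^{-(s+1)} dx = ( A(t) + 4/(1+4t²) + ζ₁'/ζ₁(s + 1/2 + it) + ζ₁'/ζ₁(s + 1/2 − it) ) / s`
(`ζ₁(s) = (s−1)ζ(s)`, Mathlib's entire `riemannZeta₁`): the poles of `−ζ'/ζ(s + 1/2 ∓ it)/s` at
`s = 1/2 ∓ it` are cancelled by the transform of `4 Re(x^{1/2−it}/(1−2it))` (the design of the template).
Inputs: Mathlib's `LSeries_eq_mul_integral'`, `LSeries_vonMangoldt_eq_deriv_riemannZeta_div`,
`integral_Ioi_cpow_of_lt`; the tree's `logDeriv_riemannZeta_eq`.  Unconditional; nothing about RH.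
-/

set_option linter.dupNamespace false

noncomputable section

open Complex Filter Topology Set MeasureTheory ArithmeticFunction

namespace Summit.RiemannHypothesis.RiemannHypothesis.Theorems.PfPersistence.Fake1.TemplateMellin

open Literature.NumberTheory.LFunctions Literature.NumberTheory.LFunctions.Landau
open Literature.NumberTheory.LFunctions.PsiOmega Literature.NumberTheory.LFunctions.Nicolas

/-! ## The three pieces -/

/-- The archimedean constant `A(t) = Re ψ(1/4 + it/2) − log π`. [folklore] -/
def tmplA (t : ℝ) : ℝ := (Complex.digamma (1 / 4 + t / 2 * I)).re - Real.log Real.pi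

/-- The coefficient `a_t(k) = Λ(k) k^{-1/2} cos(t log k)`. [folklore] -/
def coeff (t : ℝ) (k : ℕ) : ℝ := (Λ k : ℝ) * (k : ℝ) ^ (-(1 / 2 : ℝ)) * Real.cos (t * Real.log k)

/-- The prime-sum piece `C_t(x) = Σ_{k ≤ x} Λ(k) k^{-1/2} cos(t log k) = Re Σ_{k ≤ x} Λ(k) k^{-1/2-it}`.
[folklore] -/
def tmplC (t : ℝ) (x : ℝ) : ℝ := ∑ k ∈ Finset.Icc 1 ⌊x⌋₊, coeff t k

/-- The constant `κ_t = 4/(1 − 2it)` of the pole-compensating piece. [folklore] -/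
def kappa (t : ℝ) : ℂ := 4 / (1 - 2 * t * I)

/-- The exponent `w₀ = 1/2 − it`. [folklore] -/
def wzero (t : ℝ) : ℂ := 1 / 2 - t * I

/-- The pole-compensating piece `P_t(x) = 4 Re( x^{1/2−it}/(1−2it) ) = Re(κ_t x^{w₀})`. [folklore] -/
def tmplP (t : ℝ) (x : ℝ) : ℝ := (kappa t * (x : ℂ) ^ wzero t).re

/-- **The template line density** `H_t(x) = A(t) − 2 C_t(x) + P_t(x)` (FAKES §1.8.3′). [folklore] -/
def templateLD (t : ℝ) (x : ℝ) : ℝ := tmplA t - 2 * tmplC t x + tmplP t x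

/-! ## Measurability and linear bounds -/

/-- `C_t` is measurable (a step function of `⌊x⌋`). [folklore] -/
theorem measurable_tmplC (t : ℝ) : Measurable (tmplC t) :=
  (measurable_from_nat (f := fun N : ℕ ↦ ∑ k ∈ Finset.Icc 1 N, coeff t k)).comp Nat.measurable_floor

/-- `P_t` is measurable. [folklore] -/
theorem measurable_tmplP (t : ℝ) : Measurable (tmplP t) := by
  unfold tmplP
  exact Complex.measurable_re.comp ((measurable_const.mul (Complex.measurable_ofReal.pow_const _)))

/-- `H_t` is measurable. [folklore] -/
theorem measurable_templateLD (t : ℝ) : Measurable (templateLD t) := by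
  unfold templateLD
  exact ((measurable_const.sub ((measurable_tmplC t).const_mul _)).add (measurable_tmplP t))

/-- `|a_t(k)| ≤ Λ(k)`. [folklore] -/
theorem abs_coeff_le (t : ℝ) (k : ℕ) : |coeff t k| ≤ Λ k := by
  unfold coeff
  rcases Nat.eq_zero_or_pos k with rfl | hk
  · simp
  have hk1 : (1 : ℝ) ≤ k := by exact_mod_cast hk
  have h1 : (k : ℝ) ^ (-(1 / 2 : ℝ)) ≤ 1 :=
    Real.rpow_le_one_of_one_le_of_nonpos hk1 (by norm_num)
  have h2 : 0 ≤ (k : ℝ) ^ (-(1 / 2 : ℝ)) := Real.rpow_nonneg (by positivity) _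
  have h3 : |Real.cos (t * Real.log k)| ≤ 1 := Real.abs_cos_le_one _
  rw [abs_mul, abs_mul, abs_of_nonneg vonMangoldt_nonneg, abs_of_nonneg h2]
  calc (Λ k : ℝ) * (k : ℝ) ^ (-(1 / 2 : ℝ)) * |Real.cos (t * Real.log k)|
      ≤ Λ k * 1 * 1 := by gcongr
    _ = Λ k := by ring

/-- `|C_t(x)| ≤ ψ(x) ≤ (log 4 + 4) x` for `x ≥ 0`. [folklore] -/
theorem abs_tmplC_le {t x : ℝ} (hx : 0 ≤ x) : |tmplC t x| ≤ (Real.log 4 + 4) * x := by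
  unfold tmplC
  refine (Finset.abs_sum_le_sum_abs _ _).trans ?_
  refine (Finset.sum_le_sum fun k _ ↦ abs_coeff_le t k).trans ?_
  have hpsi : ∑ k ∈ Finset.Icc 1 ⌊x⌋₊, (Λ k : ℝ) = Chebyshev.psi x := by
    have := sum_Icc_vonMangoldt_eq_psi x
    exact_mod_cast this
  rw [hpsi]
  exact Chebyshev.psi_le_const_mul_self hx

/-- `‖κ_t‖ ≤ 4`. [folklore] -/
theorem norm_kappa_le (t : ℝ) : ‖kappa t‖ ≤ 4 := by
  unfold kappa
  have hden : (1 : ℝ) ≤ ‖(1 - 2 * t * I : ℂ)‖ := by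
    have h1 : ((1 - 2 * t * I : ℂ)).re = 1 := by simp
    have := Complex.abs_re_le_norm (1 - 2 * t * I : ℂ)
    rw [h1] at this
    simpa using this
  rw [norm_div]
  calc ‖(4 : ℂ)‖ / ‖(1 - 2 * t * I : ℂ)‖ ≤ ‖(4 : ℂ)‖ / 1 :=
        div_le_div_of_nonneg_left (norm_nonneg _) one_pos hden
    _ = 4 := by simp

/-- `1 − 2it ≠ 0`. [folklore] -/
theorem one_sub_ne_zero (t : ℝ) : (1 - 2 * t * I : ℂ) ≠ 0 := by
  intro h; simpa using congrArg Complex.re h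

/-- `|P_t(x)| ≤ 4 √x ≤ 4x` for `x ≥ 1`. [folklore] -/
theorem abs_tmplP_le {t x : ℝ} (hx : 1 ≤ x) : |tmplP t x| ≤ 4 * x := by
  unfold tmplP
  have hx0 : 0 < x := by linarith
  refine (Complex.abs_re_le_norm _).trans ?_
  rw [norm_mul, Complex.norm_cpow_eq_rpow_re_of_pos hx0]
  have hre : (wzero t).re = 1 / 2 := by simp [wzero]
  rw [hre]
  have hsqrt : x ^ (1 / 2 : ℝ) ≤ x := by
    calc x ^ (1 / 2 : ℝ) ≤ x ^ (1 : ℝ) :=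
          Real.rpow_le_rpow_of_exponent_le hx (by norm_num)
      _ = x := Real.rpow_one x
  calc ‖kappa t‖ * x ^ (1 / 2 : ℝ) ≤ 4 * x := by
        gcongr
        exact norm_kappa_le t

/-! ## Mellin transforms of the pieces -/

/-- The shift `w₁ = 1/2 + it`. [folklore] -/
def wone (t : ℝ) : ℂ := 1 / 2 + t * I

/-- `k^{-it} + k^{it} = 2 cos(t log k)` for `k ≥ 1`. [folklore] -/
theorem cpow_neg_add_cpow (t : ℝ) {k : ℕ} (hk : k ≠ 0) :
    (k : ℂ) ^ (-(t * I)) + (k : ℂ) ^ (t * I) = 2 * (Real.cos (t * Real.log k) : ℂ) := by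
  have hk0 : (k : ℂ) ≠ 0 := Nat.cast_ne_zero.2 hk
  rw [Complex.cpow_def_of_ne_zero hk0, Complex.cpow_def_of_ne_zero hk0, ← Complex.natCast_log,
    Complex.ofReal_cos, Complex.two_cos]
  push_cast
  rw [add_comm]
  congr 1 <;> congr 1 <;> ring

/-- The complex form of the coefficient: `a_t(k) = Λ(k) (k^{-(1/2+it)} + k^{-(1/2-it)})/2`.
[folklore] -/
theorem coeff_cast (t : ℝ) {k : ℕ} (hk : k ≠ 0) :
    (coeff t k : ℂ) = (Λ k : ℂ) * ((k : ℂ) ^ (-wone t) + (k : ℂ) ^ (-wzero t)) / 2 := by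
  have hk0 : (k : ℂ) ≠ 0 := Nat.cast_ne_zero.2 hk
  have h1 : -wone t = (-(1 / 2 : ℝ) : ℂ) + -(t * I) := by simp [wone]; ring
  have h2 : -wzero t = (-(1 / 2 : ℝ) : ℂ) + t * I := by simp [wzero]; ring
  rw [h1, h2, Complex.cpow_add _ _ hk0, Complex.cpow_add _ _ hk0, ← mul_add, cpow_neg_add_cpow t hk]
  have h3 : ((((k : ℝ) ^ (-(1 / 2) : ℝ)) : ℝ) : ℂ) = (k : ℂ) ^ (-(1 / 2) : ℂ) := by
    rw [Complex.ofReal_cpow (Nat.cast_nonneg k)]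
    push_cast
    ring_nf
  unfold coeff
  push_cast
  rw [h3]
  ring

/-- `‖a_t(k)‖ ≤ Λ(k)` (complex cast). [folklore] -/
theorem norm_coeff_cast_le (t : ℝ) (k : ℕ) : ‖(coeff t k : ℂ)‖ ≤ Λ k := by
  rw [Complex.norm_real, Real.norm_eq_abs]
  exact abs_coeff_le t k

/-- `L(a_t, s) = (L(Λ, s + 1/2 + it) + L(Λ, s + 1/2 − it))/2` for `Re s > 1/2`. [folklore] -/
theorem LSeries_coeff (t : ℝ) {s : ℂ} (hs : 1 / 2 < s.re) :
    LSeries (fun k ↦ (coeff t k : ℂ)) s =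
      (LSeries (fun k ↦ (Λ k : ℂ)) (s + wone t) + LSeries (fun k ↦ (Λ k : ℂ)) (s + wzero t)) / 2 := by
  have hs1 : 1 < (s + wone t).re := by simp [wone]; linarith
  have hs2 : 1 < (s + wzero t).re := by simp [wzero]; linarith
  have hS1 : LSeriesSummable (fun k ↦ (Λ k : ℂ)) (s + wone t) :=
    ArithmeticFunction.LSeriesSummable_vonMangoldt hs1
  have hS2 : LSeriesSummable (fun k ↦ (Λ k : ℂ)) (s + wzero t) :=
    ArithmeticFunction.LSeriesSummable_vonMangoldt hs2
  unfold LSeries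
  rw [← hS1.tsum_add hS2, ← tsum_div_const]
  refine tsum_congr fun k ↦ ?_
  rcases Nat.eq_zero_or_pos k with rfl | hk
  · simp [LSeries.term]
  have hk' : k ≠ 0 := Nat.pos_iff_ne_zero.1 hk
  have hk0 : (k : ℂ) ≠ 0 := Nat.cast_ne_zero.2 hk'
  rw [LSeries.term_of_ne_zero hk', LSeries.term_of_ne_zero hk', LSeries.term_of_ne_zero hk',
    coeff_cast t hk', Complex.cpow_add _ _ hk0, Complex.cpow_add _ _ hk0, Complex.cpow_neg,
    Complex.cpow_neg]
  have h1 : (k : ℂ) ^ s ≠ 0 := by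
    rw [Ne, Complex.cpow_eq_zero_iff]; exact fun h ↦ hk0 h.1
  have h2 : (k : ℂ) ^ wone t ≠ 0 := by
    rw [Ne, Complex.cpow_eq_zero_iff]; exact fun h ↦ hk0 h.1
  have h3 : (k : ℂ) ^ wzero t ≠ 0 := by
    rw [Ne, Complex.cpow_eq_zero_iff]; exact fun h ↦ hk0 h.1
  field_simp

/-- **Mellin transform of the prime-sum piece**: for `Re s > 1`,
`∫_1^∞ C_t(x) x^{-(s+1)} dx = (L(Λ, s+1/2+it) + L(Λ, s+1/2−it))/(2s)`. [folklore] -/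
theorem mellinIoi_tmplC (t : ℝ) {s : ℂ} (hs : 1 < s.re) :
    mellinIoi (tmplC t) s =
      (LSeries (fun k ↦ (Λ k : ℂ)) (s + wone t) + LSeries (fun k ↦ (Λ k : ℂ)) (s + wzero t)) /
        (2 * s) := by
  have hO : (fun n : ℕ ↦ ∑ k ∈ Finset.Icc 1 n, ‖(coeff t k : ℂ)‖) =O[atTop]
      fun n ↦ (n : ℝ) ^ (1 : ℝ) := by
    refine Asymptotics.IsBigO.of_bound (Real.log 4 + 4) (Eventually.of_forall fun n ↦ ?_)
    rw [Real.norm_eq_abs, Real.norm_eq_abs, Real.rpow_one, Nat.abs_cast,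
      abs_of_nonneg (Finset.sum_nonneg fun k _ ↦ norm_nonneg _)]
    refine (Finset.sum_le_sum fun k _ ↦ norm_coeff_cast_le t k).trans ?_
    have h1 : ∑ k ∈ Finset.Icc 1 n, (Λ k : ℝ) = Chebyshev.psi n := by
      have := sum_Icc_vonMangoldt_eq_psi (n : ℝ)
      rw [Nat.floor_natCast] at this
      exact_mod_cast this
    rw [h1]
    exact Chebyshev.psi_le_const_mul_self (Nat.cast_nonneg n)
  have hs' : (1 : ℝ) < s.re := hs
  have hint := LSeries_eq_mul_integral' (fun k ↦ (coeff t k : ℂ)) zero_le_one hs' hO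
  rw [LSeries_coeff t (by linarith)] at hint
  have hs0 : s ≠ 0 := by rintro rfl; simp at hs; linarith
  have hsum : ∀ x : ℝ, (∑ k ∈ Finset.Icc 1 ⌊x⌋₊, (coeff t k : ℂ)) = (tmplC t x : ℂ) := by
    intro x; unfold tmplC; push_cast; rfl
  simp_rw [hsum] at hint
  unfold mellinIoi
  rw [eq_div_iff (mul_ne_zero two_ne_zero hs0)]
  have := hint
  field_simp at this
  linear_combination (-1 : ℂ) * this

/-- `∫_1^∞ x^{a} dx = −1/(a+1)` for `Re a < −1` (complex power). [folklore] -/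
theorem integral_Ioi_one_cpow {a : ℂ} (ha : a.re < -1) :
    ∫ x in Ioi (1 : ℝ), (x : ℂ) ^ a = -1 / (a + 1) := by
  rw [integral_Ioi_cpow_of_lt ha zero_lt_one]; push_cast; rw [Complex.one_cpow]

/-- **Mellin transform of the pole-compensating piece**: for `Re s > 1/2`,
`∫_1^∞ P_t(x) x^{-(s+1)} dx = (κ_t/(s − w₀) + κ̄_t/(s − w̄₀))/2`. [folklore] -/
theorem mellinIoi_tmplP (t : ℝ) {s : ℂ} (hs : 1 / 2 < s.re) :
    mellinIoi (tmplP t) s =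
      (kappa t / (s - wzero t) + (starRingEnd ℂ) (kappa t) / (s - (starRingEnd ℂ) (wzero t))) / 2 := by
  set z₁ : ℂ := wzero t - (s + 1) with hz₁
  set z₂ : ℂ := (starRingEnd ℂ) (wzero t) - (s + 1) with hz₂
  have hz₁re : z₁.re < -1 := by simp [hz₁, wzero]; linarith
  have hz₂re : z₂.re < -1 := by simp [hz₂, wzero]; linarith
  have hpt : ∀ x ∈ Ioi (1 : ℝ), (tmplP t x : ℂ) * (x : ℂ) ^ (-(s + 1)) =
      kappa t / 2 * (x : ℂ) ^ z₁ + (starRingEnd ℂ) (kappa t) / 2 * (x : ℂ) ^ z₂ := by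
    intro x hx
    have hx0 : (0 : ℝ) < x := zero_lt_one.trans hx
    have hxC : (x : ℂ) ≠ 0 := ofReal_ne_zero.2 hx0.ne'
    have harg : (x : ℂ).arg ≠ Real.pi := by
      rw [Complex.arg_ofReal_of_nonneg hx0.le]; exact Real.pi_ne_zero.symm
    unfold tmplP
    rw [Complex.re_eq_add_conj, map_mul]
    have hconj : (starRingEnd ℂ) ((x : ℂ) ^ wzero t) = (x : ℂ) ^ (starRingEnd ℂ) (wzero t) := by
      rw [Complex.cpow_conj _ _ harg, Complex.conj_ofReal]
    rw [hconj, hz₁, hz₂, Complex.cpow_sub _ _ hxC, Complex.cpow_sub _ _ hxC, Complex.cpow_neg]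
    have hxs : (x : ℂ) ^ (s + 1) ≠ 0 := by
      rw [Ne, Complex.cpow_eq_zero_iff]; exact fun h ↦ hxC h.1
    field_simp
  unfold mellinIoi
  rw [setIntegral_congr_fun measurableSet_Ioi hpt]
  have hi₁ : IntegrableOn (fun x : ℝ ↦ kappa t / 2 * (x : ℂ) ^ z₁) (Ioi 1) :=
    (integrableOn_Ioi_cpow_of_lt hz₁re zero_lt_one).const_mul _
  have hi₂ : IntegrableOn (fun x : ℝ ↦ (starRingEnd ℂ) (kappa t) / 2 * (x : ℂ) ^ z₂) (Ioi 1) :=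
    (integrableOn_Ioi_cpow_of_lt hz₂re zero_lt_one).const_mul _
  rw [integral_add hi₁ hi₂, integral_const_mul, integral_const_mul, integral_Ioi_one_cpow hz₁re,
    integral_Ioi_one_cpow hz₂re]
  have h1 : z₁ + 1 = -(s - wzero t) := by rw [hz₁]; ring
  have h2 : z₂ + 1 = -(s - (starRingEnd ℂ) (wzero t)) := by rw [hz₂]; ring
  have hne1 : s - wzero t ≠ 0 := by
    intro h; have := congrArg Complex.re h; simp [wzero] at this; linarith
  have hne2 : s - (starRingEnd ℂ) (wzero t) ≠ 0 := by
    intro h; have := congrArg Complex.re h; simp [wzero] at this; linarith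
  rw [h1, h2]
  field_simp

/-- `∫_1^∞ 1 · x^{-(s+1)} dx = 1/s` for `Re s > 0`. [folklore] -/
theorem mellinIoi_one {s : ℂ} (hs : 0 < s.re) : mellinIoi (fun _ ↦ (1 : ℝ)) s = 1 / s := by
  have h := mellinIoi_rpow (b := 0) (s := s) (by simpa using hs)
  have hf : (fun x : ℝ ↦ x ^ (0 : ℝ)) = fun _ ↦ (1 : ℝ) := by funext x; exact Real.rpow_zero x
  rw [hf] at h
  rw [h]; push_cast; ring


/-! ## The transform of `H_t` and the pole cancellation -/

/-- `κ_t · w₀ = 2`. [folklore] -/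
theorem kappa_mul_wzero (t : ℝ) : kappa t * wzero t = 2 := by
  unfold kappa wzero
  rw [div_mul_eq_mul_div, div_eq_iff (one_sub_ne_zero t)]
  ring

/-- `1 + 2it ≠ 0`. [folklore] -/
theorem one_add_ne_zero (t : ℝ) : (1 + 2 * t * I : ℂ) ≠ 0 := by
  intro h; simpa using congrArg Complex.re h

/-- `conj κ_t = 4/(1 + 2it)`. [folklore] -/
theorem conj_kappa (t : ℝ) : (starRingEnd ℂ) (kappa t) = 4 / (1 + 2 * t * I) := by
  unfold kappa
  simp only [map_div₀, map_sub, map_one, map_mul, Complex.conj_I, Complex.conj_ofReal, map_ofNat]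
  ring

/-- `conj w₀ = 1/2 + it = w₁`. [folklore] -/
theorem conj_wzero (t : ℝ) : (starRingEnd ℂ) (wzero t) = wone t := by
  unfold wzero wone
  simp only [map_div₀, map_sub, map_one, map_mul, Complex.conj_I, Complex.conj_ofReal, map_ofNat]
  ring

/-- `κ_t + conj κ_t = 8/(1 + 4t²)`. [folklore] -/
theorem kappa_add_conj (t : ℝ) : kappa t + (starRingEnd ℂ) (kappa t) = 8 / (1 + 4 * t ^ 2) := by
  rw [conj_kappa]
  unfold kappa
  have h3 : (1 + 4 * (t : ℂ) ^ 2) ≠ 0 := by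
    have : (1 + 4 * (t : ℂ) ^ 2) = ((1 + 4 * t ^ 2 : ℝ) : ℂ) := by push_cast; ring
    rw [this, Ne, Complex.ofReal_eq_zero]; positivity
  field_simp [one_sub_ne_zero t, one_add_ne_zero t]
  ring_nf
  rw [Complex.I_sq]
  ring

/-- For `Re w > 1`: `L(Λ, w) = 1/(w − 1) − ζ₁'/ζ₁(w)`. [folklore] -/
theorem LSeries_vonMangoldt_eq_sub {w : ℂ} (hw : 1 < w.re) :
    LSeries (fun k ↦ (Λ k : ℂ)) w = 1 / (w - 1) - logDeriv riemannZeta₁ w := by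
  have hw1 : w ≠ 1 := by rintro rfl; simp at hw
  have hζ : riemannZeta w ≠ 0 := riemannZeta_ne_zero_of_one_lt_re hw
  rw [ArithmeticFunction.LSeries_vonMangoldt_eq_deriv_riemannZeta_div hw, neg_div, ← logDeriv_apply,
    logDeriv_riemannZeta_eq hw1 hζ]
  rw [one_div]
  ring

/-- **The continued transform** `N_t(s) = A(t) + 4/(1+4t²) + ζ₁'/ζ₁(s + 1/2 + it) + ζ₁'/ζ₁(s + 1/2 − it)`
(meromorphic on `ℂ`, poles exactly at `ρ − 1/2 − it` and their conjugates, `ρ` the zeros of `ζ₁`).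
[folklore] -/
def tmplN (t : ℝ) (s : ℂ) : ℂ :=
  (tmplA t : ℂ) + 4 / (1 + 4 * t ^ 2) + logDeriv riemannZeta₁ (s + wone t) +
    logDeriv riemannZeta₁ (s + wzero t)

/-- Integrability of the pieces against `x^{-(s+1)}` for `Re s > 1`. [folklore] -/
theorem integrable_piece {f : ℝ → ℝ} (hf : Measurable f) {K : ℝ} (hK : ∀ x, 1 < x → |f x| ≤ K * x)
    {s : ℂ} (hs : 1 < s.re) :
    Integrable (fun x : ℝ ↦ (f x : ℂ) * (x : ℂ) ^ (-(s + 1))) (volume.restrict (Ioi 1)) :=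
  integrable_ofReal_mul_cpow_of_re hf (integrableOn_rpow_of_abs_le_mul_self hf hK hs)

/-- **Mellin transform of the template line density** (FAKES §1.8.3′, the pole cancellation): for
`Re s > 1`, `∫_1^∞ H_t(x) x^{-(s+1)} dx = N_t(s)/s`. [folklore] -/
theorem mellinIoi_templateLD (t : ℝ) {s : ℂ} (hs : 1 < s.re) :
    mellinIoi (templateLD t) s = tmplN t s / s := by
  have hs0 : s ≠ 0 := by rintro rfl; simp at hs; linarith
  have hs1 : 1 < (s + wone t).re := by simp [wone]; linarith
  have hs2 : 1 < (s + wzero t).re := by simp [wzero]; linarith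
  have iA : Integrable (fun x : ℝ ↦ ((fun _ : ℝ ↦ tmplA t) x : ℂ) * (x : ℂ) ^ (-(s + 1)))
      (volume.restrict (Ioi 1)) :=
    integrable_piece measurable_const (K := |tmplA t|)
      (fun x hx ↦ le_mul_of_one_le_right (abs_nonneg _) hx.le) hs
  have iC : Integrable (fun x : ℝ ↦ ((fun x ↦ 2 * tmplC t x) x : ℂ) * (x : ℂ) ^ (-(s + 1)))
      (volume.restrict (Ioi 1)) := by
    refine integrable_piece ((measurable_tmplC t).const_mul 2) (K := 2 * (Real.log 4 + 4)) ?_ hs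
    intro x hx
    rw [abs_mul, abs_of_pos (by norm_num : (0 : ℝ) < 2), mul_assoc]
    exact mul_le_mul_of_nonneg_left (abs_tmplC_le (by linarith)) (by norm_num)
  have iP : Integrable (fun x : ℝ ↦ (tmplP t x : ℂ) * (x : ℂ) ^ (-(s + 1)))
      (volume.restrict (Ioi 1)) :=
    integrable_piece (measurable_tmplP t) (K := 4) (fun x hx ↦ abs_tmplP_le hx.le) hs
  have iAC : Integrable (fun x : ℝ ↦ ((fun x ↦ tmplA t - 2 * tmplC t x) x : ℂ) * (x : ℂ) ^ (-(s + 1)))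
      (volume.restrict (Ioi 1)) := by
    have := iA.sub iC
    refine this.congr (Eventually.of_forall fun x ↦ ?_)
    simp only [Pi.sub_apply]
    push_cast
    ring
  have hLD : templateLD t = fun x ↦ (fun x ↦ tmplA t - 2 * tmplC t x) x + tmplP t x := by
    funext x; simp [templateLD]
  rw [hLD, mellinIoi_add' iAC iP]
  rw [show (fun x ↦ tmplA t - 2 * tmplC t x) = fun x ↦ (fun _ : ℝ ↦ tmplA t) x - (fun x ↦ 2 * tmplC t x) x
    from rfl, mellinIoi_sub' iA iC, mellinIoi_const_mul (g := tmplC t) 2 s]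
  have hA : mellinIoi (fun _ : ℝ ↦ tmplA t) s = tmplA t * (1 / s) := by
    rw [← mellinIoi_one (by linarith : 0 < s.re), ← mellinIoi_const_mul]
    simp
  rw [hA, mellinIoi_tmplC t hs, mellinIoi_tmplP t (by linarith), LSeries_vonMangoldt_eq_sub hs1,
    LSeries_vonMangoldt_eq_sub hs2, conj_wzero]
  have e1 : s + wone t - 1 = s - wzero t := by simp [wone, wzero]; ring
  have e2 : s + wzero t - 1 = s - wone t := by simp [wone, wzero]; ring
  have hne1 : s - wzero t ≠ 0 := by
    intro h; have := congrArg Complex.re h; simp [wzero] at this; linarith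
  have hne2 : s - wone t ≠ 0 := by
    intro h; have := congrArg Complex.re h; simp [wone] at this; linarith
  have hk1 : kappa t * wzero t = 2 := kappa_mul_wzero t
  have hk2 : (starRingEnd ℂ) (kappa t) * wone t = 2 := by
    rw [← conj_wzero, ← map_mul, kappa_mul_wzero]; exact map_ofNat _ 2
  have hk3 := kappa_add_conj t
  have h3 : (1 + 4 * (t : ℂ) ^ 2) ≠ 0 := by
    have : (1 + 4 * (t : ℂ) ^ 2) = ((1 + 4 * t ^ 2 : ℝ) : ℂ) := by push_cast; ring
    rw [this, Ne, Complex.ofReal_eq_zero]; positivity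
  rw [e1, e2]
  unfold tmplN
  rw [show (1 : ℂ) / (s - wzero t) = kappa t * wzero t / 2 / (s - wzero t) by rw [hk1]; norm_num,
    show (1 : ℂ) / (s - wone t) = (starRingEnd ℂ) (kappa t) * wone t / 2 / (s - wone t) by
      rw [hk2]; norm_num,
    show (4 : ℂ) / (1 + 4 * (t : ℂ) ^ 2) = (kappa t + (starRingEnd ℂ) (kappa t)) / 2 by
      rw [hk3]; field_simp; norm_num]
  push_cast
  field_simp
  ring

end Summit.RiemannHypothesis.RiemannHypothesis.Theorems.PfPersistence.Fake1.TemplateMellin
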